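import Summits.Ventures.DiscreteObjects.Hadamard.FixedStructure

/-!
# Hadamard 668 census, family F12 — permutation lemmas for automorphisms of composite order (kernel, general)

Framing: lottery ticket; floor = certified bounds/negative ranges.

Cell pub-namedobj (venture DiscreteObjects), target (H), hadamard gen 11.  Small general lemmas used by the
composite-order exclusions `115, 161, 253 ∉ {orders of automorphisms of H(668)}` (`CompositeOrder23`):
* `perm_fixed_of_pow_coprime`: if `σ^a x = x`, `σ^b x = x` with `a, b` coprime (`b > 1`) then `σ x = x`;
* `dvd_card_moved_fixed` (centraliser lemma): if `σ^p = 1` (`p` prime) and `h` commutes with `σ`, the number of points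
  MOVED by `σ` and FIXED by `h` is divisible by `p` (an `h`-fixed point of a `σ`-orbit makes the whole orbit `h`-fixed);
* `card_fixed_on_mod`: for `h^q = 1` (`q` prime) and an `h`-stable predicate `P`, `#{P ∧ h-fixed} ≡ #{P} (mod q)`;
* `card_filter_subtypePerm_pow`: fixed points of a power of a restricted permutation, counted in the ambient type.
Ours (elementary), not literature; no `sorry`.
-/

namespace Summit.Ventures.DiscreteObjects.Hadamard

open Finset BigOperators

variable {ι : Type*} [Fintype ι] [DecidableEq ι]

omit [Fintype ι] [DecidableEq ι] in
/-- **coprime exponents**: `σ^a x = x` and `σ^b x = x` with `a, b` coprime and `b > 1` force `σ x = x` -/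
lemma perm_fixed_of_pow_coprime (σ : Equiv.Perm ι) {a b : ℕ} (hab : Nat.Coprime a b) (hb : 1 < b) {x : ι}
    (ha : (σ ^ a) x = x) (hbx : (σ ^ b) x = x) : σ x = x := by
  obtain ⟨m, -, hm⟩ := Nat.exists_mul_mod_eq_one_of_coprime hab hb
  have h1 : (σ ^ (a * m)) x = x := by rw [pow_mul]; exact perm_pow_apply_of_fixed _ ha m
  have h2 : (σ ^ (b * (a * m / b))) x = x := by rw [pow_mul]; exact perm_pow_apply_of_fixed _ hbx _
  have e : a * m = b * (a * m / b) + 1 := by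
    have := Nat.div_add_mod (a * m) b
    omega
  rw [e, pow_succ', Equiv.Perm.mul_apply, h2] at h1
  exact h1

omit [Fintype ι] [DecidableEq ι] in
/-- for `x` with `σ^b x = x` (`b > 1`) and `a` coprime to `b`: `σ^a x = x ↔ σ x = x` -/
lemma perm_pow_fixed_iff_of_coprime (σ : Equiv.Perm ι) {a b : ℕ} (hab : Nat.Coprime a b) (hb : 1 < b) {x : ι}
    (hbx : (σ ^ b) x = x) : (σ ^ a) x = x ↔ σ x = x :=
  ⟨fun ha => perm_fixed_of_pow_coprime σ hab hb ha hbx, fun h => perm_pow_apply_of_fixed σ h a⟩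

omit [Fintype ι] [DecidableEq ι] in
/-- powers of `σ` commute pointwise -/
lemma perm_pow_comm_apply (σ : Equiv.Perm ι) (a b : ℕ) (x : ι) : (σ ^ a) ((σ ^ b) x) = (σ ^ b) ((σ ^ a) x) := by
  rw [← Equiv.Perm.mul_apply, ← pow_add, add_comm, pow_add, Equiv.Perm.mul_apply]

/-- **Centraliser lemma.**  If `σ^p = 1` with `p` prime and `h` commutes with `σ`, then `p` divides the number of points
moved by `σ` and fixed by `h`. -/
lemma dvd_card_moved_fixed (σ h : Equiv.Perm ι) {p : ℕ} (hp : p.Prime) (hσ : σ ^ p = 1)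
    (hcomm : ∀ j, σ (h j) = h (σ j)) :
    p ∣ (univ.filter fun j => σ j ≠ j ∧ h j = j).card := by
  have hS : ∀ j, (σ (σ j) ≠ σ j ∧ h (σ j) = σ j) ↔ (σ j ≠ j ∧ h j = j) := by
    intro j
    constructor
    · rintro ⟨h1, h2⟩
      refine ⟨fun e => h1 (by rw [e, e]), ?_⟩
      rw [← hcomm] at h2
      exact σ.injective h2
    · rintro ⟨h1, h2⟩
      exact ⟨fun e => h1 (σ.injective e), by rw [← hcomm, h2]⟩
  set ρ : Equiv.Perm {j // σ j ≠ j ∧ h j = j} := σ.subtypePerm hS with hρdef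
  have hρ : ρ ^ p = 1 := by
    ext x
    simp [hρdef, Equiv.Perm.subtypePerm_pow, hσ]
  have hfix : (univ.filter fun x => ρ x = x).card = 0 := by
    rw [Finset.card_eq_zero, Finset.filter_eq_empty_iff]
    intro x _ hx
    apply x.2.1
    have := congrArg Subtype.val hx
    simpa [hρdef] using this
  have hmod := card_fixed_mod ρ hp hρ
  rw [hfix, Nat.zero_mod, Fintype.card_subtype] at hmod
  exact Nat.dvd_of_mod_eq_zero hmod.symm

/-- **Fixed points on a stable subset, mod q.**  If `h^q = 1` (`q` prime) and the predicate `P` is `h`-stable, then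
`#{j | P j ∧ h j = j} ≡ #{j | P j} (mod q)`. -/
lemma card_fixed_on_mod (h : Equiv.Perm ι) {q : ℕ} (hq : q.Prime) (hh : h ^ q = 1) (P : ι → Prop) [DecidablePred P]
    (hP : ∀ j, P (h j) ↔ P j) :
    (univ.filter fun j => P j ∧ h j = j).card % q = (univ.filter fun j => P j).card % q := by
  set ρ : Equiv.Perm {j // P j} := h.subtypePerm hP with hρdef
  have hρ : ρ ^ q = 1 := by
    ext x
    simp [hρdef, Equiv.Perm.subtypePerm_pow, hh]
  have hmod := card_fixed_mod ρ hq hρ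
  rw [Fintype.card_subtype] at hmod
  rw [← hmod]
  congr 1
  rw [← Fintype.card_subtype, ← Fintype.card_subtype]
  refine Fintype.card_congr ((Equiv.subtypeSubtypeEquivSubtypeInter P (fun j => h j = j)).symm.trans ?_)
  refine Equiv.subtypeEquivRight ?_
  intro x
  constructor
  · intro hx; exact Subtype.ext (by simpa [hρdef] using hx)
  · intro hx; have := congrArg Subtype.val hx; simpa [hρdef] using this

/-- fixed points of a power of a restricted permutation, counted in the ambient type -/
lemma card_filter_subtypePerm_pow (σ : Equiv.Perm ι) (P : ι → Prop) [DecidablePred P] (hP : ∀ j, P (σ j) ↔ P j)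
    (k : ℕ) :
    (univ.filter fun x : {j // P j} => ((σ.subtypePerm hP) ^ k) x = x).card
      = (univ.filter fun j => P j ∧ (σ ^ k) j = j).card := by
  rw [← Fintype.card_subtype, ← Fintype.card_subtype]
  refine Fintype.card_congr (Equiv.trans (Equiv.subtypeEquivRight ?_) (Equiv.subtypeSubtypeEquivSubtypeInter P _))
  intro x
  rw [Equiv.Perm.subtypePerm_pow]
  constructor
  · intro hx; have := congrArg Subtype.val hx; simpa using this
  · intro hx; exact Subtype.ext (by simpa using hx)

omit [DecidableEq ι] in
/-- splitting a filter count by a second predicate -/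
lemma card_filter_split (A B : ι → Prop) [DecidablePred A] [DecidablePred B] :
    (univ.filter A).card = (univ.filter fun j => A j ∧ B j).card + (univ.filter fun j => A j ∧ ¬ B j).card := by
  rw [← Finset.card_filter_add_card_filter_not (s := univ.filter A) (p := B), Finset.filter_filter,
    Finset.filter_filter]

end Summit.Ventures.DiscreteObjects.Hadamard
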